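import Literature.Analysis.Convexity.DinesYuan
import Literature.Computability.QuantumComplexity.HilbertSchmidtKraus
import Mathlib.Analysis.InnerProductSpace.Basic
import HarnessLib

/-!
# The Frobenius-norm contraction lemma for one-qubit channels (Kempe–Regev–Unger–de Wolf, Lemma 8)

For a completely positive trace-preserving map `G(X) = Σᵢ Kᵢ X Kᵢ†` (`Σᵢ Kᵢ† Kᵢ = 1`) on the
`2 × 2` complex matrices, J. Kempe, O. Regev, F. Unger and R. de Wolf (*Upper bounds on the
noise threshold for fault-tolerant quantum computing*, Quantum Inf. Comput. 10 (2010) 361–376,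
Lemma 8) prove: there is `β ∈ [0, 1]` such that for every Hermitian `δ`,
`δ̂'(X)² + δ̂'(Y)² + δ̂'(Z)² ≤ (1 − β) δ̂(I)² + β (δ̂(X)² + δ̂(Y)² + δ̂(Z)²)`, where `δ' = G(δ)` and
`δ̂(P) = Tr(δ P)` are the Pauli coefficients. Since `Σ_{P ∈ {I,X,Y,Z}} |Tr(δ P)|² = 2 ‖δ‖²_F`
and `Tr G(δ) = Tr δ`, the printed inequality is equivalent to the Frobenius-norm form
`‖G(δ)‖²_F ≤ (1 − β) |Tr δ|² + β ‖δ‖²_F`, which is what is proved here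
(`kempeEtAl_lemma8`, for all complex `2 × 2` inputs; the Pauli form is derived where the Pauli
basis lives).

## Proof (not the printed one)

The source derives Lemma 8 from the Ruskai–Szarek–Werner normal form of qubit channels. We give a
direct proof: (1) *positivity* — for Hermitian `δ` with spectral decomposition
`δ = λ P_e + μ P_f`, `G(δ) = λ ρ_e + μ ρ_f` with `ρ_e, ρ_f` density matrices, and
`0 ≤ Tr(ρ_e ρ_f) ≤ 1`, `Tr ρ² ≤ 1` give `‖G(δ)‖² ≤ max ((Tr δ)², ‖δ‖²)`
(`hsNormSq_krausMap_le_max`; this is where dimension `2` enters); (2) *Yuan's lemma*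
(`Literature.Analysis.Convexity.yuan_lemma`, via Dines' theorem) applied to the two real quadratic
forms `(Tr δ)² − ‖G δ‖²` and `‖δ‖² − ‖G δ‖²` on the real vector space of Hermitian matrices turns
the pointwise `max ≥ 0` into one convex combination `≥ 0`, i.e. the claim for Hermitian inputs;
(3) complex inputs `X = A + iB` (`A, B` Hermitian) follow from
`‖A + iB‖² = ‖A‖² + ‖B‖²`, `|Tr(A + iB)|² = (Tr A)² + (Tr B)²`.

## Contents

* `hsNormSq_krausMap_le_max` — the positivity bound in dimension two;
* `hermPart`, `hsQuad`, `trQuad` — the Hermitian part and the real quadratic forms `‖X‖²_F`,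
  `|Tr X|²` on `Matrix n n ℂ` viewed as a real vector space (inputs to Yuan's lemma);
* `exists_hsNormSq_krausMap_le_of_isHermitian`, `kempeEtAl_lemma8`.

(`hsNormSq`, `krausMap` and the positive-matrix facts are in `HilbertSchmidtKraus.lean`.)

## References

* [KempeEtAl2010] J. Kempe, O. Regev, F. Unger, R. de Wolf, Quantum Inf. Comput. 10 (2010)
  361–376 (arXiv:0802.1464), Lemma 8, p. 10 (read via `lit read doi:10.26421/qic10.5-6-1`).
* [PolikTerlaky2007] I. Pólik, T. Terlaky, SIAM Review 49 (2007), Lemma 2.7 (Yuan's lemma).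
-/

namespace Literature.Computability.QuantumComplexity

open Matrix Literature.MathematicalPhysics.QuantumLattice Literature.Analysis.Convexity
open Literature.LinearAlgebra.Matrix (re_trace_mul_nonneg_of_posSemidef)
open scoped ComplexOrder

variable {n : Type*} [Fintype n]

/-! ### The positivity inequality in dimension two -/

section Positivity

variable [DecidableEq n] {ι : Type*} [Fintype ι]

/-- **Positivity bound (qubits).** For a trace-preserving Kraus map `G` on `2 × 2` matrices and
Hermitian `X`: `‖G X‖²_F ≤ max (|Tr X|², ‖X‖²_F)`. (Spectral decomposition `X = λ P_e + μ P_f`: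
`‖G X‖² = λ² Tr ρ_e² + μ² Tr ρ_f² + 2λμ Tr(ρ_e ρ_f)` with `0 ≤ Tr(ρ_e ρ_f) ≤ 1`, `Tr ρ² ≤ 1`.)
[folklore] -/
theorem hsNormSq_krausMap_le_max (hn : Fintype.card n = 2) (K : ι → Matrix n n ℂ)
    (hK : ∑ i, (K i)ᴴ * K i = 1) {X : Matrix n n ℂ} (hX : X.IsHermitian) :
    hsNormSq (krausMap K X) ≤ max (‖X.trace‖ ^ 2) (hsNormSq X) := by
  set U : Matrix n n ℂ := (hX.eigenvectorUnitary : Matrix n n ℂ) with hU_def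
  set d : n → ℝ := hX.eigenvalues with hd_def
  have hU : U ∈ Matrix.unitaryGroup n ℂ := hX.eigenvectorUnitary.2
  set P : n → Matrix n n ℂ := fun j => vecMulVec (fun a => U a j) (star fun a => U a j) with hP
  set ρ : n → Matrix n n ℂ := fun j => krausMap K (P j) with hρ
  have hXsum : X = ∑ j, (d j : ℂ) • P j := eq_sum_eigenvalues_smul_proj hX
  have hρpsd : ∀ j, (ρ j).PosSemidef := fun j =>
    posSemidef_krausMap (posSemidef_vecMulVec_self_star (fun a => U a j)) K
  have hρtr : ∀ j, (ρ j).trace.re = 1 := by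
    intro j
    rw [hρ, trace_krausMap hK, hP, trace_vecMulVec, dotProduct_star_col_of_mem_unitaryGroup hU,
      Complex.one_re]
  have hGX : krausMap K X = ∑ j, (d j : ℂ) • ρ j := by
    rw [hXsum, krausMap_sum]
    simp only [krausMap_smul, hρ]
  -- the squared norm of `G X` as a double sum
  have hherm : (krausMap K X)ᴴ = krausMap K X := (isHermitian_krausMap hX K).eq
  have hhs : hsNormSq (krausMap K X) = ∑ j, ∑ l, d j * d l * ((ρ j * ρ l).trace).re := by
    rw [← re_trace_mul_conjTranspose_self, hherm, hGX, Finset.sum_mul, trace_sum, Complex.re_sum]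
    refine Finset.sum_congr rfl fun j _ => ?_
    rw [Finset.mul_sum, trace_sum, Complex.re_sum]
    refine Finset.sum_congr rfl fun l _ => ?_
    rw [smul_mul_assoc, mul_smul_comm, smul_smul, trace_smul, smul_eq_mul, Complex.mul_re,
      ← Complex.ofReal_mul, Complex.ofReal_re, Complex.ofReal_im, zero_mul, sub_zero]
  have ht0 : ∀ j l, 0 ≤ ((ρ j * ρ l).trace).re := fun j l =>
    re_trace_mul_nonneg_of_posSemidef (hρpsd j) (hρpsd l)
  have ht1 : ∀ j l, ((ρ j * ρ l).trace).re ≤ 1 := fun j l => by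
    simpa [hρtr] using re_trace_mul_le_of_posSemidef (hρpsd j) (hρpsd l)
  have htrX : ‖X.trace‖ ^ 2 = (∑ j, d j) ^ 2 := by
    rw [norm_trace_sq_of_isHermitian hX, hX.trace_eq_sum_eigenvalues, Complex.re_sum]
    exact congrArg (· ^ 2) (Finset.sum_congr rfl fun j _ => Complex.ofReal_re _)
  have hhsX : hsNormSq X = ∑ j, d j ^ 2 := hsNormSq_eq_sum_sq_eigenvalues hX
  -- enumerate the two indices
  obtain ⟨j₀, j₁, hne, huniv⟩ := Finset.card_eq_two.mp
    (show (Finset.univ : Finset n).card = 2 by rw [Finset.card_univ, hn])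
  rw [hhs, htrX, hhsX]
  simp only [huniv, Finset.sum_pair hne]
  have e00 := ht1 j₀ j₀
  have e11 := ht1 j₁ j₁
  have e01 := ht1 j₀ j₁
  have e10 := ht1 j₁ j₀
  have f01 := ht0 j₀ j₁
  have f10 := ht0 j₁ j₀
  have g0 : d j₀ * d j₀ * ((ρ j₀ * ρ j₀).trace).re ≤ d j₀ ^ 2 := by
    nlinarith [mul_self_nonneg (d j₀)]
  have g1 : d j₁ * d j₁ * ((ρ j₁ * ρ j₁).trace).re ≤ d j₁ ^ 2 := by
    nlinarith [mul_self_nonneg (d j₁)]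
  rcases le_or_gt 0 (d j₀ * d j₁) with hpos | hneg
  · apply le_max_of_le_left
    have g2 : d j₀ * d j₁ * ((ρ j₀ * ρ j₁).trace).re ≤ d j₀ * d j₁ := by nlinarith
    have g3 : d j₁ * d j₀ * ((ρ j₁ * ρ j₀).trace).re ≤ d j₀ * d j₁ := by nlinarith
    nlinarith
  · apply le_max_of_le_right
    have g2 : d j₀ * d j₁ * ((ρ j₀ * ρ j₁).trace).re ≤ 0 := by nlinarith
    have g3 : d j₁ * d j₀ * ((ρ j₁ * ρ j₀).trace).re ≤ 0 := by nlinarith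
    nlinarith

end Positivity

/-! ### Real quadratic forms on matrices and the Hermitian part -/

section Forms

/-- The Hermitian part `X ↦ (X + X†)/2`, as an `ℝ`-linear map. [folklore] -/
noncomputable def hermPart : Matrix n n ℂ →ₗ[ℝ] Matrix n n ℂ where
  toFun X := (2⁻¹ : ℂ) • (X + Xᴴ)
  map_add' X Y := by
    rw [conjTranspose_add, ← smul_add]
    congr 1
    abel
  map_smul' c X := by
    rw [conjTranspose_smul, star_trivial, RingHom.id_apply, ← smul_add, smul_comm]

omit [Fintype n] in
/-- Unfolding of `hermPart`. [folklore] -/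
theorem hermPart_apply (X : Matrix n n ℂ) : hermPart X = (2⁻¹ : ℂ) • (X + Xᴴ) := rfl

omit [Fintype n] in
/-- The Hermitian part is Hermitian. [folklore] -/
theorem isHermitian_hermPart (X : Matrix n n ℂ) : (hermPart X).IsHermitian := by
  rw [IsHermitian, hermPart_apply, conjTranspose_smul, conjTranspose_add,
    conjTranspose_conjTranspose, add_comm]
  congr 1
  rw [Complex.star_def, map_inv₀, map_ofNat]

omit [Fintype n] in
/-- The Hermitian part of a Hermitian matrix is itself. [folklore] -/
theorem hermPart_of_isHermitian {X : Matrix n n ℂ} (hX : X.IsHermitian) : hermPart X = X := by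
  rw [hermPart_apply, hX.eq, ← two_smul ℂ X, smul_smul]
  norm_num

omit [Fintype n] in
/-- Cartesian decomposition: `X = hermPart X + i · hermPart (−i X)`. [folklore] -/
theorem hermPart_add_I_smul_hermPart (X : Matrix n n ℂ) :
    hermPart X + Complex.I • hermPart ((-Complex.I) • X) = X := by
  have hs : star (-Complex.I) = Complex.I := by
    rw [star_neg, Complex.star_def, Complex.conj_I, neg_neg]
  rw [hermPart_apply, hermPart_apply, conjTranspose_smul, hs, smul_comm Complex.I (2⁻¹ : ℂ),
    smul_add Complex.I, smul_smul, smul_smul, mul_neg, Complex.I_mul_I, neg_neg, one_smul,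
    neg_one_smul, ← smul_add]
  have h2 : X + Xᴴ + (X + -Xᴴ) = (2 : ℂ) • X := by rw [two_smul]; abel
  rw [h2, smul_smul]
  norm_num

/-- The Hilbert–Schmidt real inner product `(X, Y) ↦ re Tr(X Y†)` as an `ℝ`-bilinear form.
[folklore] -/
noncomputable def hsBilin : LinearMap.BilinForm ℝ (Matrix n n ℂ) :=
  LinearMap.mk₂ ℝ (fun X Y => (X * Yᴴ).trace.re)
    (fun X₁ X₂ Y => by simp only [add_mul, trace_add, Complex.add_re])
    (fun c X Y => by simp only [Matrix.smul_mul, trace_smul, Complex.smul_re, smul_eq_mul])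
    (fun X Y₁ Y₂ => by simp only [conjTranspose_add, mul_add, trace_add, Complex.add_re])
    (fun c X Y => by
      simp only [conjTranspose_smul, star_trivial, Matrix.mul_smul, trace_smul, Complex.smul_re,
        smul_eq_mul])

/-- The squared Hilbert–Schmidt norm as a real quadratic form. [folklore] -/
noncomputable def hsQuad : QuadraticForm ℝ (Matrix n n ℂ) :=
  hsBilin.toQuadraticMap

/-- `hsQuad X = ‖X‖²_F`. [folklore] -/
@[simp] theorem hsQuad_apply (X : Matrix n n ℂ) : hsQuad X = hsNormSq X := by
  rw [hsQuad, LinearMap.BilinMap.toQuadraticMap_apply, hsBilin, LinearMap.mk₂_apply,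
    re_trace_mul_conjTranspose_self]

/-- The trace as an `ℝ`-linear map to `ℂ`. [folklore] -/
noncomputable def traceR : Matrix n n ℂ →ₗ[ℝ] ℂ :=
  (Matrix.traceLinearMap n ℂ ℂ).restrictScalars ℝ

/-- `|Tr X|²` as a real quadratic form. [folklore] -/
noncomputable def trQuad : QuadraticForm ℝ (Matrix n n ℂ) :=
  LinearMap.BilinMap.toQuadraticMap ((innerₗ ℂ).compl₁₂ traceR traceR)

/-- `trQuad X = |Tr X|²`. [folklore] -/
@[simp] theorem trQuad_apply (X : Matrix n n ℂ) : trQuad X = ‖X.trace‖ ^ 2 := by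
  rw [trQuad, LinearMap.BilinMap.toQuadraticMap_apply, LinearMap.compl₁₂_apply, innerₗ_apply_apply,
    real_inner_self_eq_norm_sq]
  rfl

end Forms

/-! ### Lemma 8 -/

section Lemma8

variable [DecidableEq n] {ι : Type*} [Fintype ι]

/-- **Lemma 8 for Hermitian inputs**: by Yuan's lemma applied to the real quadratic forms
`|Tr H|² − ‖G H‖²_F` and `‖H‖²_F − ‖G H‖²_F` of the Hermitian part `H` of `X`, whose pointwise
maximum is nonnegative by `hsNormSq_krausMap_le_max`.
[cite: KempeEtAl2010, Lemma 8] -/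
theorem exists_hsNormSq_krausMap_le_of_isHermitian (hn : Fintype.card n = 2)
    (K : ι → Matrix n n ℂ) (hK : ∑ i, (K i)ᴴ * K i = 1) :
    ∃ β : ℝ, 0 ≤ β ∧ β ≤ 1 ∧ ∀ X : Matrix n n ℂ, X.IsHermitian →
      hsNormSq (krausMap K X) ≤ (1 - β) * ‖X.trace‖ ^ 2 + β * hsNormSq X := by
  let G : Matrix n n ℂ →ₗ[ℝ] Matrix n n ℂ := (krausMapL K).restrictScalars ℝ
  let QP : QuadraticForm ℝ (Matrix n n ℂ) := hsQuad.comp G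
  let QA : QuadraticForm ℝ (Matrix n n ℂ) := (trQuad - QP).comp hermPart
  let QB : QuadraticForm ℝ (Matrix n n ℂ) := (hsQuad - QP).comp hermPart
  have hQP : ∀ X, QP X = hsNormSq (krausMap K X) := fun X => by
    simp [QP, G, QuadraticMap.comp_apply]
  have hQA : ∀ X, QA X = ‖(hermPart X).trace‖ ^ 2 - hsNormSq (krausMap K (hermPart X)) :=
    fun X => by simp [QA, QuadraticMap.comp_apply, QuadraticMap.sub_apply, hQP]
  have hQB : ∀ X, QB X = hsNormSq (hermPart X) - hsNormSq (krausMap K (hermPart X)) :=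
    fun X => by simp [QB, QuadraticMap.comp_apply, QuadraticMap.sub_apply, hQP]
  obtain ⟨μ, h0, h1, hμ⟩ := yuan_lemma QA QB fun X => by
    have hH := hsNormSq_krausMap_le_max hn K hK (isHermitian_hermPart X)
    rw [hQA, hQB]
    rcases le_max_iff.mp hH with h | h
    · exact Or.inl (by linarith)
    · exact Or.inr (by linarith)
  refine ⟨1 - μ, by linarith, by linarith, fun X hX => ?_⟩
  have h := hμ X
  rw [hQA, hQB, hermPart_of_isHermitian hX] at h
  nlinarith

/-- **Kempe–Regev–Unger–de Wolf, Lemma 8** (Frobenius form, all complex inputs). For every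
trace-preserving Kraus map `G(X) = Σᵢ Kᵢ X Kᵢ†`, `Σᵢ Kᵢ† Kᵢ = 1`, on `2 × 2` complex matrices
there is `β ∈ [0, 1]` such that `‖G X‖²_F ≤ (1 − β) |Tr X|² + β ‖X‖²_F` for all `X`. In the
Pauli basis (`Σ_P |Tr(X P)|² = 2‖X‖²_F`, `Tr G X = Tr X`) this is the printed statement
"`δ̂'(X)² + δ̂'(Y)² + δ̂'(Z)² ≤ (1 − β) δ̂(I)² + β (δ̂(X)² + δ̂(Y)² + δ̂(Z)²)`" (there for Hermitian
`δ`; complex inputs follow by `X = A + iB`). [cite: KempeEtAl2010, Lemma 8] -/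
theorem kempeEtAl_lemma8 (hn : Fintype.card n = 2) (K : ι → Matrix n n ℂ)
    (hK : ∑ i, (K i)ᴴ * K i = 1) :
    ∃ β : ℝ, 0 ≤ β ∧ β ≤ 1 ∧ ∀ X : Matrix n n ℂ,
      hsNormSq (krausMap K X) ≤ (1 - β) * ‖X.trace‖ ^ 2 + β * hsNormSq X := by
  obtain ⟨β, h0, h1, hβ⟩ := exists_hsNormSq_krausMap_le_of_isHermitian hn K hK
  refine ⟨β, h0, h1, fun X => ?_⟩
  set A := hermPart X with hA_def
  set B := hermPart ((-Complex.I) • X) with hB_def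
  have hA : A.IsHermitian := isHermitian_hermPart _
  have hB : B.IsHermitian := isHermitian_hermPart _
  have hXAB : X = A + Complex.I • B := (hermPart_add_I_smul_hermPart X).symm
  have hGX : krausMap K X = krausMap K A + Complex.I • krausMap K B := by
    conv_lhs => rw [hXAB, krausMap_add, krausMap_smul]
  have htrA : ‖A.trace‖ ^ 2 = A.trace.re ^ 2 := norm_trace_sq_of_isHermitian hA
  have htrB : ‖B.trace‖ ^ 2 = B.trace.re ^ 2 := norm_trace_sq_of_isHermitian hB
  calc hsNormSq (krausMap K X)
      = hsNormSq (krausMap K A) + hsNormSq (krausMap K B) := by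
        rw [hGX, hsNormSq_add_I_smul (isHermitian_krausMap hA K) (isHermitian_krausMap hB K)]
    _ ≤ ((1 - β) * ‖A.trace‖ ^ 2 + β * hsNormSq A) +
          ((1 - β) * ‖B.trace‖ ^ 2 + β * hsNormSq B) := add_le_add (hβ A hA) (hβ B hB)
    _ = (1 - β) * (A.trace.re ^ 2 + B.trace.re ^ 2) + β * (hsNormSq A + hsNormSq B) := by
        rw [htrA, htrB]
        ring
    _ = (1 - β) * ‖X.trace‖ ^ 2 + β * hsNormSq X := by
        rw [← norm_trace_add_I_smul_sq hA hB, ← hsNormSq_add_I_smul hA hB, ← hXAB]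

end Lemma8

end Literature.Computability.QuantumComplexity
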